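import Summits.ValiantsHypothesis.ValiantsHypothesis.Theses.FeketeSOS

/-!
# `FeketeSOS.CharPSparseSOS` (stmt-ValiantsHypothesis-14989) — negative side: the diagonal obstruction (small-model structure)

Standing disprover (cdisprove, cycle 1), from `Cruxes/CharPSparseSOS/Disproof.lean` §(c).
`diag_poison`: in characteristic `p > 5` the equations `2cxy = ε₁`, `cx² = ε₂`, `cy² = ε₃` with `ε_i² = 1` are inconsistent
(`ε₁² = 4ε₂ε₃` and `ε₂²ε₃² = 1` give `16 = 1`, i.e. `p ∣ 15`).  In a cyclic representation `X^p − 1 ∣ Σ c_i g_i² − F̄_p` the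
coefficient at a position `n` is `Σ_{a+b≡n} c_i g_i(a)g_i(b)`; if an off-diagonal sum `a + b` (`a ≠ b ∈ supp g_i`) receives no
other contribution its coefficient is `2c_i g_i(a)g_i(b) = χ_p(a+b) = ±1`, and then the diagonal positions `2a`, `2b` cannot both
be clean (`c_i g_i(a)² = χ_p(2a)`, `c_i g_i(b)² = χ_p(2b)`).  Consequences (Disproof.lean): sumset packings hitting every position
exactly once never represent `F̄_p` (`p > 5`); every cheap representation carries `≳ Σ_i #supp g_i` forced additive coincidences;
the single-fat-square patterns of the linear form `(p+3)/4` at `p = 47, 53` die by this count.  A structural fact for BOTH sides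
(the prover may use it as a lemma about cheap configurations). [folklore]
-/

set_option linter.dupNamespace false

namespace Summit.ValiantsHypothesis.ValiantsHypothesis.Theorems.CharPSparseSOS.Negative

section Diagonal

/-- **Diagonal poisoning.**  In characteristic `p > 5` the three equations `2cxy = ε₁`, `cx² = ε₂`, `cy² = ε₃` with
`ε_i = ±1` are inconsistent (`ε₁² = 4ε₂ε₃` forces `16 = 1`).  Reading: in a cyclic representation
`Σ c_i g_i² ≡ F̄_p`, if an off-diagonal sum `n = a + b` (`a ≠ b ∈ supp g_i`) receives no other contribution
(so its coefficient is `2c_i g_i(a) g_i(b) = χ_p(n) = ±1`), then the two diagonal positions `2a`, `2b` cannot BOTH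
be clean (coefficient `c_i g_i(a)² = χ_p(2a)`): at least one of them is a collision (another pair of the same or
another square lands there) or a mismatch.  Consequences recorded in the module docstring: exact ("each position
once") sumset packings never represent `F̄_p` for `p > 5`; every cheap representation carries `≳ Σ_i #supp g_i`
forced additive coincidences; the single-fat-square patterns of the linear form die at `p = 47, 53` by this count
alone (exp/linear). [folklore] -/
theorem diag_poison {K : Type} [Field K] (p : ℕ) [Fact p.Prime] [CharP K p] (hp : 5 < p)
    (c x y ε₁ ε₂ ε₃ : K) (h₁ : ε₁ ^ 2 = 1) (h₂ : ε₂ ^ 2 = 1) (h₃ : ε₃ ^ 2 = 1)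
    (e₁ : 2 * c * x * y = ε₁) (e₂ : c * x ^ 2 = ε₂) (e₃ : c * y ^ 2 = ε₃) : False := by
  have h4 : (4 : K) * (ε₂ * ε₃) = 1 := by
    rw [← h₁, ← e₁, ← e₂, ← e₃]; ring
  have h16 : (16 : K) = 1 := by
    linear_combination (4 * (ε₂ * ε₃) + 1) * h4 - 16 * ε₃ ^ 2 * h₂ - 16 * h₃
  have h15 : ((15 : ℕ) : K) = 0 := by
    have : (16 : K) - 1 = 0 := by rw [h16, sub_self]
    have e : ((15 : ℕ) : K) = (16 : K) - 1 := by push_cast; ring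
    rw [e, this]
  rw [CharP.cast_eq_zero_iff K p] at h15
  have hle : p ≤ 15 := Nat.le_of_dvd (by norm_num) h15
  have hprime : p.Prime := Fact.out
  interval_cases p <;> first | exact absurd h15 (by decide) | exact absurd hprime (by decide)

end Diagonal

end Summit.ValiantsHypothesis.ValiantsHypothesis.Theorems.CharPSparseSOS.Negative
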